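import Summits.Ventures.PercRepro.RankLevelSetBiIndepProfile

/-! # RankLevelSetBiIndepPerElem — THE PER-ELEMENT PROFILE INEQUALITY (★★), ITS DOUBLE COUNTING, THE MONOTONE
FORM OF THE PROFILE, AND THE GLOBAL LEVEL-WISE FORM FROM EITHER HYPOTHESIS (night-1 g24; dossier §36)

For a finite matroid `M` on `E` (`#E = n`) with bi-independent profile `D_r = #biIndep M r` (`RankLevelSetBiIndepProfile`),
the global level-wise theorems of gen 23 (`levelHallUp_members_of_biIndepULC` and its two corollaries) use of the
named fact `BiIndepULC M` (ultra-log-concavity, a Lorentzian theorem of the published literature) ONLY the consequence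
«the normalised profile `d_r = D_r / C(n,r)` is nondecreasing up to the middle» (with the symmetry `D_r = D_{n−r}`).
This file isolates that consequence as `BiIndepMono M` and gives it a SECOND, elementary-looking source:

* `BiIndepPerElem M` (a `Prop`, NOT asserted) — THE PER-ELEMENT INEQUALITY (★★): for every element `y` and every
  `2j + 1 < n`, `#{Z ∈ D_j : y ∉ Z} ≤ #{Q ∈ D_{j+1} : y ∈ Q}` («the bi-independent `(j+1)`-sets through `y` are at
  least as many as the bi-independent `j`-sets avoiding `y`»). Census (night-1 g24, own exact code): EVERY matroid
  on ≤ 8 elements, every `y`, every `j` — 41 / 81 / 393 / 1,032 / 11,541 `(M, y, j)` instances at `n = 4 … 8`, 0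
  failures; random GF(2) / GF(3) matroids on 9 and 10 elements, 0 failures. Not proved here.
* `BiIndepMono M` (a `Prop`) — THE MONOTONE FORM: `(n − j)·D_j ≤ (j + 1)·D_{j+1}` for `2j + 1 < n`.
* `sum_ncard_filter_mem`, `sum_ncard_filter_not_mem` — the double counting `Σ_y #{Q ∈ 𝒟 : y ∈ Q} = Σ_Q #Q` and
  `Σ_y #{Q ∈ 𝒟 : y ∉ Q} = Σ_Q #(E ∖ Q)`; `sum_mem_biIndep`, `sum_not_mem_biIndep`: the two sides summed over `y`
  are `(j+1)·D_{j+1}` and `(n−j)·D_j`.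
* **`biIndepMono_of_perElem`**: (★★) summed over the elements IS the monotone form;
  **`biIndepMono_of_biIndepULC`**: the monotone form also follows from the ULC fact (symmetry + `lc_symm_ge`).
* `biIndepNorm_le_succ_iff`, `biIndepNorm_mono_of_mono`, `biIndepNorm_compl`, **`biIndepNorm_ge_of_mono`**: the
  normalised profile is nondecreasing up to the middle and symmetric, hence `d_q ≤ d_t` for `q ≤ t ≤ n − q`.
* **`levelHallUp_members_of_biIndepMono`**, **`levelHallUp_members_rank_of_biIndepMono`**,
  **`hallUp_members_of_biIndepMono`** — gen 23's three global theorems (the `𝒜 = 𝒵` case of `LevelHallUpC025` at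
  every level and of `HallUpC025`, at the tight layer of a rank-`p` matroid) from `BiIndepMono M`; and the same three
  from `BiIndepPerElem M` (`…_of_perElem`).
Nothing here asserts (★★) or ULC; every declaration has a docstring; imports: the cell's own modules and Mathlib only.
Axioms: standard. -/

namespace PercRepro

open Set Matroid Finset

variable {α : Type} (M : Matroid α) [M.Finite]

/-! ## The two hypotheses -/

omit [M.Finite] in
/-- **THE PER-ELEMENT PROFILE INEQUALITY (★★)** (night-1 g24; a `Prop`, NOT asserted): for every element `y ∈ E` and
every `j` with `2j + 1 < #E`, the bi-independent `j`-sets avoiding `y` are at most as many as the bi-independent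
`(j+1)`-sets containing `y`. Census-clean on every matroid with ≤ 8 elements and on random GF(2)/GF(3) matroids with
9 and 10 elements (dossier §36); summed over `y` it is `BiIndepMono M` (`biIndepMono_of_perElem`). -/
def BiIndepPerElem : Prop :=
  ∀ y ∈ M.E, ∀ j : ℕ, 2 * j + 1 < M.E.ncard →
    {Z ∈ biIndep M j | y ∉ Z}.ncard ≤ {Q ∈ biIndep M (j + 1) | y ∈ Q}.ncard

omit [M.Finite] in
/-- **THE MONOTONE FORM OF THE PROFILE** (a `Prop`): `(#E − j)·D_j ≤ (j + 1)·D_{j+1}` whenever `2j + 1 < #E`, i.e.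
the normalised profile `D_r / C(#E, r)` is nondecreasing up to the middle (`biIndepNorm_le_succ_iff`). It follows from
`BiIndepULC M` (`biIndepMono_of_biIndepULC`) and from `BiIndepPerElem M` (`biIndepMono_of_perElem`). -/
def BiIndepMono : Prop :=
  ∀ j : ℕ, 2 * j + 1 < M.E.ncard →
    (M.E.ncard - j) * biIndepCount M j ≤ (j + 1) * biIndepCount M (j + 1)

/-! ## Double counting -/

/-- **Double counting the incidences**: for a finite family `𝒟` of subsets of `E`,
`Σ_{y ∈ E} #{Q ∈ 𝒟 : y ∈ Q} = Σ_{Q ∈ 𝒟} #Q`. -/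
lemma sum_ncard_filter_mem (𝒟 : Set (Set α)) (h𝒟 : 𝒟.Finite) (hsub : ∀ Q ∈ 𝒟, Q ⊆ M.E) :
    ∑ y ∈ M.ground_finite.toFinset, {Q ∈ 𝒟 | y ∈ Q}.ncard = ∑ Q ∈ h𝒟.toFinset, Q.ncard := by
  classical
  have h1 : ∀ y, {Q ∈ 𝒟 | y ∈ Q}.ncard = #(h𝒟.toFinset.filter (fun Q => y ∈ Q)) := by
    intro y
    rw [← Set.ncard_coe_finset]
    congr 1
    ext Q
    simp only [Finset.coe_filter, Set.mem_setOf_eq, h𝒟.mem_toFinset]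
  have h2 : ∀ Q ∈ h𝒟.toFinset, Q.ncard = #(M.ground_finite.toFinset.filter (fun y => y ∈ Q)) := by
    intro Q hQ
    rw [h𝒟.mem_toFinset] at hQ
    rw [← Set.ncard_coe_finset]
    congr 1
    ext y
    simp only [Finset.coe_filter, Set.mem_setOf_eq, M.ground_finite.mem_toFinset]
    exact ⟨fun h => ⟨hsub Q hQ h, h⟩, fun h => h.2⟩
  rw [Finset.sum_congr rfl (fun y _ => h1 y), Finset.sum_congr rfl h2]
  simp only [Finset.card_filter]
  exact Finset.sum_comm

/-- **Double counting the non-incidences**: `Σ_{y ∈ E} #{Q ∈ 𝒟 : y ∉ Q} = Σ_{Q ∈ 𝒟} #(E ∖ Q)`. -/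
lemma sum_ncard_filter_not_mem (𝒟 : Set (Set α)) (h𝒟 : 𝒟.Finite) :
    ∑ y ∈ M.ground_finite.toFinset, {Q ∈ 𝒟 | y ∉ Q}.ncard = ∑ Q ∈ h𝒟.toFinset, (M.E \ Q).ncard := by
  classical
  have h1 : ∀ y, {Q ∈ 𝒟 | y ∉ Q}.ncard = #(h𝒟.toFinset.filter (fun Q => y ∉ Q)) := by
    intro y
    rw [← Set.ncard_coe_finset]
    congr 1
    ext Q
    simp only [Finset.coe_filter, Set.mem_setOf_eq, h𝒟.mem_toFinset]
  have h2 : ∀ Q ∈ h𝒟.toFinset, (M.E \ Q).ncard = #(M.ground_finite.toFinset.filter (fun y => y ∉ Q)) := by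
    intro Q _
    rw [← Set.ncard_coe_finset]
    congr 1
    ext y
    simp only [Finset.coe_filter, Set.mem_setOf_eq, Set.mem_sdiff, M.ground_finite.mem_toFinset]
  rw [Finset.sum_congr rfl (fun y _ => h1 y), Finset.sum_congr rfl h2]
  simp only [Finset.card_filter]
  exact Finset.sum_comm

/-- `Σ_{y ∈ E} #{Q ∈ D_j : y ∈ Q} = j · D_j`. -/
lemma sum_mem_biIndep (j : ℕ) :
    ∑ y ∈ M.ground_finite.toFinset, {Q ∈ biIndep M j | y ∈ Q}.ncard = j * biIndepCount M j := by
  rw [sum_ncard_filter_mem M (biIndep M j) (biIndep_finite M j) (fun Q hQ => hQ.1)]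
  rw [Finset.sum_const_nat (m := j) (fun Q hQ => ((biIndep_finite M j).mem_toFinset.mp hQ).2.1)]
  rw [mul_comm]
  unfold biIndepCount
  rw [Set.ncard_eq_toFinset_card _ (biIndep_finite M j)]

/-- `Σ_{y ∈ E} #{Z ∈ D_j : y ∉ Z} = (#E − j) · D_j` for `j ≤ #E`. -/
lemma sum_not_mem_biIndep (j : ℕ) :
    ∑ y ∈ M.ground_finite.toFinset, {Z ∈ biIndep M j | y ∉ Z}.ncard = (M.E.ncard - j) * biIndepCount M j := by
  rw [sum_ncard_filter_not_mem M (biIndep M j) (biIndep_finite M j)]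
  rw [Finset.sum_const_nat (m := M.E.ncard - j) (fun Z hZ => ?_)]
  · rw [mul_comm]
    unfold biIndepCount
    rw [Set.ncard_eq_toFinset_card _ (biIndep_finite M j)]
  · obtain ⟨hZE, hcard, -, -⟩ := (biIndep_finite M j).mem_toFinset.mp hZ
    rw [Set.ncard_sdiff' hZE M.ground_finite, hcard]

/-! ## The two sources of the monotone form -/

/-- **(★★) summed over the elements is the monotone form**: `BiIndepPerElem M → BiIndepMono M`. -/
theorem biIndepMono_of_perElem (h : BiIndepPerElem M) : BiIndepMono M := by
  intro j hj
  have hsum : ∑ y ∈ M.ground_finite.toFinset, {Z ∈ biIndep M j | y ∉ Z}.ncard ≤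
      ∑ y ∈ M.ground_finite.toFinset, {Q ∈ biIndep M (j + 1) | y ∈ Q}.ncard :=
    Finset.sum_le_sum (fun y hy => h y (M.ground_finite.mem_toFinset.mp hy) j hj)
  rwa [sum_not_mem_biIndep M j, sum_mem_biIndep M (j + 1)] at hsum

omit [M.Finite] in
/-- **The one-step criterion**: for `j + 1 ≤ #E`, `d_j ≤ d_{j+1}` iff `(#E − j)·D_j ≤ (j + 1)·D_{j+1}`
(`C(n, j+1)·(j+1) = C(n, j)·(n − j)`). -/
lemma biIndepNorm_le_succ_iff (j : ℕ) (hj : j + 1 ≤ M.E.ncard) :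
    biIndepNorm M j ≤ biIndepNorm M (j + 1) ↔
      (M.E.ncard - j) * biIndepCount M j ≤ (j + 1) * biIndepCount M (j + 1) := by
  set n := M.E.ncard with hn
  have hCj : (0 : ℚ) < (n.choose j : ℚ) := by exact_mod_cast Nat.choose_pos (by omega)
  have hCj1 : (0 : ℚ) < (n.choose (j + 1) : ℚ) := by exact_mod_cast Nat.choose_pos hj
  have hj1 : (0 : ℚ) < ((j + 1 : ℕ) : ℚ) := by positivity
  have hid : ((n.choose (j + 1) : ℕ) : ℚ) * ((j + 1 : ℕ) : ℚ) =
      ((n.choose j : ℕ) : ℚ) * ((n - j : ℕ) : ℚ) := by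
    exact_mod_cast Nat.choose_succ_right_eq n j
  unfold biIndepNorm
  rw [← hn, div_le_div_iff₀ hCj hCj1]
  constructor
  · intro h
    have h' : ((n - j : ℕ) : ℚ) * (biIndepCount M j : ℚ) * (n.choose j : ℚ) ≤
        ((j + 1 : ℕ) : ℚ) * (biIndepCount M (j + 1) : ℚ) * (n.choose j : ℚ) := by
      calc ((n - j : ℕ) : ℚ) * (biIndepCount M j : ℚ) * (n.choose j : ℚ)
          = (biIndepCount M j : ℚ) * ((n.choose j : ℚ) * ((n - j : ℕ) : ℚ)) := by ring
        _ = (biIndepCount M j : ℚ) * ((n.choose (j + 1) : ℚ) * ((j + 1 : ℕ) : ℚ)) := by rw [hid]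
        _ = (biIndepCount M j : ℚ) * (n.choose (j + 1) : ℚ) * ((j + 1 : ℕ) : ℚ) := by ring
        _ ≤ (biIndepCount M (j + 1) : ℚ) * (n.choose j : ℚ) * ((j + 1 : ℕ) : ℚ) :=
            mul_le_mul_of_nonneg_right h hj1.le
        _ = ((j + 1 : ℕ) : ℚ) * (biIndepCount M (j + 1) : ℚ) * (n.choose j : ℚ) := by ring
    have h'' := le_of_mul_le_mul_right h' hCj
    exact_mod_cast h''
  · intro h
    have h' : ((n - j : ℕ) : ℚ) * (biIndepCount M j : ℚ) ≤
        ((j + 1 : ℕ) : ℚ) * (biIndepCount M (j + 1) : ℚ) := by exact_mod_cast h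
    have h'' : (biIndepCount M j : ℚ) * (n.choose (j + 1) : ℚ) * ((j + 1 : ℕ) : ℚ) ≤
        (biIndepCount M (j + 1) : ℚ) * (n.choose j : ℚ) * ((j + 1 : ℕ) : ℚ) := by
      calc (biIndepCount M j : ℚ) * (n.choose (j + 1) : ℚ) * ((j + 1 : ℕ) : ℚ)
          = (biIndepCount M j : ℚ) * ((n.choose (j + 1) : ℚ) * ((j + 1 : ℕ) : ℚ)) := by ring
        _ = (biIndepCount M j : ℚ) * ((n.choose j : ℚ) * ((n - j : ℕ) : ℚ)) := by rw [hid]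
        _ = (n.choose j : ℚ) * (((n - j : ℕ) : ℚ) * (biIndepCount M j : ℚ)) := by ring
        _ ≤ (n.choose j : ℚ) * (((j + 1 : ℕ) : ℚ) * (biIndepCount M (j + 1) : ℚ)) :=
            mul_le_mul_of_nonneg_left h' hCj.le
        _ = (biIndepCount M (j + 1) : ℚ) * (n.choose j : ℚ) * ((j + 1 : ℕ) : ℚ) := by ring
    exact le_of_mul_le_mul_right h'' hj1

/-- **The ULC fact gives the monotone form**: `BiIndepULC M → BiIndepMono M` (symmetry `D_j = D_{n−j}` and the
log-concave sequence lemma `lc_symm_ge` on `[j, n − j]`). -/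
theorem biIndepMono_of_biIndepULC (hULC : BiIndepULC M) : BiIndepMono M := by
  intro j hj
  obtain ⟨hlc, hnz⟩ := hULC
  set n := M.E.ncard with hn
  by_cases hD : biIndepCount M j = 0
  · rw [hD]; simp
  have hjpos : 0 < biIndepCount M j := Nat.pos_of_ne_zero hD
  have hsym : biIndepCount M (n - j) = biIndepCount M j := biIndepCount_compl M j (by omega)
  have hpos : ∀ r, j ≤ r → r ≤ n - j → 0 < biIndepNorm M r := by
    intro r hjr hrn
    unfold biIndepNorm
    have hDr : 0 < biIndepCount M r := hnz j r (n - j) hjr hrn hjpos (by rwa [hsym])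
    have hC : 0 < ((M.E.ncard).choose r : ℚ) := by exact_mod_cast Nat.choose_pos (by omega)
    exact div_pos (by exact_mod_cast hDr) hC
  have hlc' : ∀ r, j + 1 ≤ r → r + 1 ≤ n - j →
      biIndepNorm M (r - 1) * biIndepNorm M (r + 1) ≤ biIndepNorm M r ^ 2 :=
    fun r hr hr' => hlc r (by omega) (by omega)
  have hend : biIndepNorm M j ≤ biIndepNorm M (n - j) := by
    unfold biIndepNorm
    rw [hsym, ← hn, Nat.choose_symm (by omega)]
  have hstep := lc_symm_ge (biIndepNorm M) j (n - j) hpos hlc' hend (j + 1) (by omega) (by omega)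
  exact (biIndepNorm_le_succ_iff M j (by omega)).mp hstep

/-! ## The normalised profile under the monotone form -/

omit [M.Finite] in
/-- Under `BiIndepMono M` the normalised profile is nondecreasing on `[a, b]` whenever `2b ≤ #E`. -/
lemma biIndepNorm_mono_of_mono (h : BiIndepMono M) (a b : ℕ) (hab : a ≤ b) (hb : 2 * b ≤ M.E.ncard) :
    biIndepNorm M a ≤ biIndepNorm M b := by
  induction b, hab using Nat.le_induction with
  | base => exact le_rfl
  | succ b hab ih =>
    refine (ih (by omega)).trans ?_
    exact (biIndepNorm_le_succ_iff M b (by omega)).mpr (h b (by omega))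

/-- **The symmetry of the normalised profile**: `d_{#E − r} = d_r` for `r ≤ #E`. -/
lemma biIndepNorm_compl (r : ℕ) (hr : r ≤ M.E.ncard) :
    biIndepNorm M (M.E.ncard - r) = biIndepNorm M r := by
  unfold biIndepNorm
  rw [biIndepCount_compl M r hr, Nat.choose_symm hr]

/-- **The normalised profile dominates its end value on `[q, #E − q]`** under `BiIndepMono M`: `d_q ≤ d_t` for
`q ≤ t` and `t + q ≤ #E` (nondecreasing up to the middle, then the symmetry). -/
theorem biIndepNorm_ge_of_mono (h : BiIndepMono M) {q t : ℕ} (hqt : q ≤ t) (htq : t + q ≤ M.E.ncard) :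
    biIndepNorm M q ≤ biIndepNorm M t := by
  by_cases ht : 2 * t ≤ M.E.ncard
  · exact biIndepNorm_mono_of_mono M h q t hqt ht
  · rw [← biIndepNorm_compl M t (by omega)]
    exact biIndepNorm_mono_of_mono M h q (M.E.ncard - t) (by omega) (by omega)

/-! ## The global level-wise form from the monotone form -/

/-- **THE GLOBAL LEVEL-WISE FORM AT EVERY LEVEL, FROM THE MONOTONE FORM** (tight layer `#E = p + q`, rank `p`,
`q < t < p`): `C(p+q,t)·#𝒵 ≤ C(p+q,q)·#{S ∈ upNbhd 𝒵 : S independent, #S = t}` — CONDITIONAL on `BiIndepMono M`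
(gen 23's `levelHallUp_members_of_biIndepULC` with the weaker hypothesis). -/
theorem levelHallUp_members_of_biIndepMono (h : BiIndepMono M) {p q t : ℕ} (hE : M.E.ncard = p + q)
    (hrk : M.eRank = (p : ℕ∞)) (hqt : q < t) (htp : t < p) :
    ((p + q).choose t : ℚ) * ((cellMembers M p q).ncard : ℚ) ≤
      ((p + q).choose q : ℚ) * ((indepLevelNbhd M p q t (cellMembers M p q)).ncard : ℚ) := by
  rw [indepLevelNbhd_members_eq_biIndep M hE hrk hqt htp, cellMembers_eq_biIndep M hE]
  change ((p + q).choose t : ℚ) * (biIndepCount M q : ℚ) ≤ ((p + q).choose q : ℚ) * (biIndepCount M t : ℚ)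
  have hmain := biIndepNorm_ge_of_mono M h hqt.le (by omega : t + q ≤ M.E.ncard)
  unfold biIndepNorm at hmain
  rw [hE] at hmain
  have hCq : 0 < ((p + q).choose q : ℚ) := by exact_mod_cast Nat.choose_pos (by omega)
  have hCt : 0 < ((p + q).choose t : ℚ) := by exact_mod_cast Nat.choose_pos (by omega)
  rw [div_le_div_iff₀ hCq hCt] at hmain
  linarith

/-- **The same with the rank-`t` UP-neighbours** — the `𝒜 = 𝒵` case of `LevelHallUpC025` at the tight layer of a
rank-`p` matroid, CONDITIONAL on `BiIndepMono M`. -/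
theorem levelHallUp_members_rank_of_biIndepMono (h : BiIndepMono M) {p q t : ℕ} (hE : M.E.ncard = p + q)
    (hrk : M.eRank = (p : ℕ∞)) (hqt : q < t) (htp : t < p) :
    ((p + q).choose t : ℚ) * ((cellMembers M p q).ncard : ℚ) ≤
      ((p + q).choose q : ℚ) *
        ({S ∈ upNbhd M p q (cellMembers M p q) | M.eRk S = (t : ℕ∞)}.ncard : ℚ) :=
  levelHallUp_of_indepLevel p q t (cellMembers M p q)
    (levelHallUp_members_of_biIndepMono M h hE hrk hqt htp)

/-- **The `𝒜 = 𝒵` case of C-044 UP at the tight layer** (`phiK p q · #𝒵 ≤ #upNbhd 𝒵`), CONDITIONAL on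
`BiIndepMono M`: the level inequalities summed over `q < t < p`. -/
theorem hallUp_members_of_biIndepMono (h : BiIndepMono M) {p q : ℕ} (hE : M.E.ncard = p + q)
    (hrk : M.eRank = (p : ℕ∞)) :
    phiK p q * ((cellMembers M p q).ncard : ℚ) ≤ ((upNbhd M p q (cellMembers M p q)).ncard : ℚ) := by
  classical
  have hsplit := ncard_eq_sum_ncard_level (M := M) p q (upNbhd M p q (cellMembers M p q))
    (upNbhd_subset_cellY (M := M) (cellMembers M p q) p q)
  have hchoose : (0 : ℚ) < ((p + q).choose p : ℚ) := by
    exact_mod_cast Nat.choose_pos (by omega)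
  have hsym : ((p + q).choose q : ℚ) = ((p + q).choose p : ℚ) := by
    exact_mod_cast (Nat.choose_symm_add (a := p) (b := q)).symm
  rw [hsplit]
  unfold phiK
  rw [div_mul_eq_mul_div, div_le_iff₀ hchoose, Finset.sum_mul, Finset.sum_mul]
  refine Finset.sum_le_sum (fun t ht => ?_)
  rw [Finset.mem_Ioo] at ht
  have := levelHallUp_members_rank_of_biIndepMono M h hE hrk ht.1 ht.2
  rw [hsym] at this
  linarith

/-! ## The same three theorems from the per-element inequality (★★) -/

/-- **The global level-wise form at every level from (★★)** (`BiIndepPerElem M`), tight layer, rank `p`, `q < t < p`. -/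
theorem levelHallUp_members_of_perElem (h : BiIndepPerElem M) {p q t : ℕ} (hE : M.E.ncard = p + q)
    (hrk : M.eRank = (p : ℕ∞)) (hqt : q < t) (htp : t < p) :
    ((p + q).choose t : ℚ) * ((cellMembers M p q).ncard : ℚ) ≤
      ((p + q).choose q : ℚ) * ((indepLevelNbhd M p q t (cellMembers M p q)).ncard : ℚ) :=
  levelHallUp_members_of_biIndepMono M (biIndepMono_of_perElem M h) hE hrk hqt htp

/-- **The `𝒜 = 𝒵` case of `LevelHallUpC025` at the tight layer from (★★)**. -/
theorem levelHallUp_members_rank_of_perElem (h : BiIndepPerElem M) {p q t : ℕ} (hE : M.E.ncard = p + q)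
    (hrk : M.eRank = (p : ℕ∞)) (hqt : q < t) (htp : t < p) :
    ((p + q).choose t : ℚ) * ((cellMembers M p q).ncard : ℚ) ≤
      ((p + q).choose q : ℚ) *
        ({S ∈ upNbhd M p q (cellMembers M p q) | M.eRk S = (t : ℕ∞)}.ncard : ℚ) :=
  levelHallUp_members_rank_of_biIndepMono M (biIndepMono_of_perElem M h) hE hrk hqt htp

/-- **The `𝒜 = 𝒵` case of C-044 UP at the tight layer from (★★)**. -/
theorem hallUp_members_of_perElem (h : BiIndepPerElem M) {p q : ℕ} (hE : M.E.ncard = p + q)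
    (hrk : M.eRank = (p : ℕ∞)) :
    phiK p q * ((cellMembers M p q).ncard : ℚ) ≤ ((upNbhd M p q (cellMembers M p q)).ncard : ℚ) :=
  hallUp_members_of_biIndepMono M (biIndepMono_of_perElem M h) hE hrk

end PercRepro
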